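import Summits.BirchSwinnertonDyer.BirchSwinnertonDyer.Theorems.GoldfeldAllTwistsTwoConverseTwinSplitCells
import Summits.BirchSwinnertonDyer.Rank1Residual.X12.CMNoPrimeTorsion
import Summits.BirchSwinnertonDyer.Rank1Residual.X12.CMTwoTorsionExact
import Literature.NumberTheory.EllipticCurves.MazurTorsionOrderValuationProofs
import Literature.NumberTheory.EllipticCurves.BSDQuadraticDescentPeriodEliminationProofs
import Literature.AlgebraicGeometry.PlaneCurves.HessePencilHarmonicMembers
import HarnessLib

set_option linter.dupNamespace false
set_option autoImplicit false

/-!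
# Two constants of the `BSD(E,2)` twin on the `ℚ(√−7)` corner: `#E(ℚ)_tors = 2` for EVERY
# `ℚ(√−7)`-CM curve, and the number of real components (`1` for `j = −3375`, `2` for `j = 16581375`)

Cell `bsd-goldfeld`, seat `s1p-c3` (prover); third file for item stmt-BirchSwinnertonDyer-19350
(`Theses.GoldfeldAllTwistsTwoConverse.BSDTwoCMSplitRankOne`, the `BSD(E,2)` twin: CM, `2` split in the
CM field, analytic rank `1`). The route text lists "every constant at `2` (Tamagawa `c₂` of the additive
twists, Manin constant, the unit index `u`)" as support lemmas on demand; the `L`-free reformulation of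
the twin's one open cell (`P2.bsdp_two_iff_cmHeegnerIndex`, line `heegner-index-at-two` of item 19140)
reads `#Ш(E)` against the quotient `P2.cmHeegnerIndexQuotient`, which carries the factors
`(W.torsionOrder)²` and `(W.baseChange ℝ).numRealComponents`. This file computes both on the whole
corner, as THEOREMS (no named fact, no definition):

* §1 `numRealComponents_eq_one_of_j_lt` / `numRealComponents_eq_two_of_lt_j`: for an elliptic `W/ℚ`,
  `j < 1728 ⟹ Δ < 0 ⟹ E(ℝ)` connected; `j > 1728 ⟹ Δ > 0 ⟹` two components
  (`(j − 1728)·Δ = c₆²`, tree `Literature.AlgebraicGeometry.PlaneCurves.j_sub_1728_mul_Δ`); hence `1` component for `j = −3375` (`49a1`-type) and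
  `2` for `j = 16581375` (`49a2`-type).
* §2 **`torsionOrder_eq_two_of_cmSplit_two`: every elliptic curve over `ℚ` with `2` split in its CM
  field (`j ∈ {−3375, 16581375}`) has `#E(ℚ)_tors = 2`** (any model; classically Olson 1974's table).
  Proof, compositions of tree theorems BY NAME: (a) `E(ℚ)[2] = {O, T}` exactly
  (`X12.existsUnique_twoTorsion_of_cmFieldDiscrOfJ_eq_neg_seven`); (b) no rational point of odd prime
  order `q`: `q ≥ 5` by `X12.eq_zero_of_nsmul_eq_zero_of_hasCM` (Deuring + Dirichlet), `q = 3` by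
  irreducibility of `E[3]` (`3` unramified in `ℚ(√−7)`, `X12.noPTorsion_isogenyClass_of_not_cmRamified`);
  (c) no rational point of order `4`: at a prime `ℓ ≡ 5 (mod 28)` beyond the bad primes (Dirichlet,
  Mathlib `Nat.forall_exists_prime_gt_and_eq_mod`) `ℓ` is INERT in `ℚ(√−7)`
  (`legendreSym_neg_seven_eq_neg_one`: `(−7/ℓ) = (ℓ/7) = (5/7) = −1`), so `a_ℓ = 0` (Deuring,
  `X12.frobeniusTrace_eq_zero_of_legendreSym_cmFieldDiscr_eq_neg_one` on a maximal-order isogenous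
  minimal model, transported by Faltings' isogeny invariance `frobeniusTrace_eq_of_isIsogenous`),
  `#Ẽ(𝔽_ℓ) = ℓ + 1 ≡ 6 (mod 28)` is `2 ·` odd, and every rational torsion point has order dividing
  `#Ẽ(𝔽_ℓ)` (*AEC* VII.3.1(b), `addOrderOf_dvd_reductionPointCount`). So every rational torsion point is
  killed by `2` (`two_nsmul_eq_zero_of_isOfFinAddOrder_of_cmSplit_two`) and `E(ℚ)_tors = E(ℚ)[2] ≃ ℤ/2`.

HONEST FRAMING: elementary constants; nothing here proves `BSD(W,2)` for any curve; BSD is not proved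
by any of this.

References: L. D. Olson, Manuscripta Math. 14 (1974) 195–205 (torsion of CM elliptic curves over `ℚ`;
not used, re-proved); A. Burungale, F. Castella, C. Skinner, Y. Tian, Ann. Math. Qué. 46 (2022) Rem. D
[BurungaleCastellaSkinnerTian2022]; J. H. Silverman, *AEC* 2nd ed., III.1 (`c_relation`), V Ex. 5.9,
VII.3.1(b), Cor. VII.7.2 [SilvermanAEC2009]; S. Lang, *Elliptic Functions*, Ch. 13 §4 Thm. 12
[Lang1987]; G. Faltings, Invent. Math. 73 (1983) §5 Kor. 2 [Faltings1983Endlichkeit]; J. E. Cremona,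
*Algorithms* (1997) §3.3, §3.7 [Cremona1997].
-/

noncomputable section

open scoped Classical

open WeierstrassCurve Literature.NumberTheory.EllipticCurves
  Literature.NumberTheory.EllipticCurves.Rank1Residual
  Summit.BirchSwinnertonDyer.Rank1Residual

namespace Summit.BirchSwinnertonDyer.BirchSwinnertonDyer.Theorems.GoldfeldGoodTwists

/-! ## §1 Real components from the sign of `j − 1728` -/

section RealComponents

variable (W : WeierstrassCurve ℚ) [W.IsElliptic]

/-- `j < 1728 ⟹ Δ < 0`. [cite: SilvermanAEC2009, III.1 and V Ex. 5.9] -/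
theorem Δ_neg_of_j_lt (hj : W.j < 1728) : W.Δ < 0 := by
  have h := Literature.AlgebraicGeometry.PlaneCurves.j_sub_1728_mul_Δ W
  have hΔ0 : W.Δ ≠ 0 := W.isUnit_Δ.ne_zero
  have hsq : 0 ≤ W.c₆ ^ 2 := sq_nonneg _
  rcases lt_trichotomy W.Δ 0 with hlt | heq | hgt
  · exact hlt
  · exact absurd heq hΔ0
  · have : (W.j - 1728) * W.Δ < 0 := mul_neg_of_neg_of_pos (by linarith) hgt
    linarith

/-- `1728 < j ⟹ 0 < Δ` (`c₆ ≠ 0` off `j = 1728`). [cite: SilvermanAEC2009, III.1 and V Ex. 5.9] -/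
theorem Δ_pos_of_lt_j (hj : 1728 < W.j) : 0 < W.Δ := by
  have h := Literature.AlgebraicGeometry.PlaneCurves.j_sub_1728_mul_Δ W
  have hΔ0 : W.Δ ≠ 0 := W.isUnit_Δ.ne_zero
  have hc6 : W.c₆ ≠ 0 := fun h0 =>
    absurd ((Literature.AlgebraicGeometry.PlaneCurves.j_eq_1728_iff_c₆_eq_zero W).2 h0) (ne_of_gt hj)
  have hsq : 0 < W.c₆ ^ 2 := by positivity
  rcases lt_trichotomy W.Δ 0 with hlt | heq | hgt
  · have : (W.j - 1728) * W.Δ < 0 := mul_neg_of_pos_of_neg (by linarith) hlt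
    linarith
  · exact absurd heq hΔ0
  · exact hgt

/-- **`j < 1728 ⟹ E(ℝ)` is connected** (one real component). [cite: Cremona1997, §3.7] -/
theorem numRealComponents_eq_one_of_j_lt (hj : W.j < 1728) :
    (W.baseChange ℝ).numRealComponents = 1 := by
  rw [numRealComponents_baseChange_real, if_neg (not_lt.mpr (Δ_neg_of_j_lt W hj).le)]

/-- **`j > 1728 ⟹ E(ℝ)` has two components.** [cite: Cremona1997, §3.7] -/
theorem numRealComponents_eq_two_of_lt_j (hj : 1728 < W.j) :
    (W.baseChange ℝ).numRealComponents = 2 := by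
  rw [numRealComponents_baseChange_real, if_pos (Δ_pos_of_lt_j W hj)]

/-- `j = −3375` (`49a1` and its twists): ONE real component. [cite: Cremona1997, §3.7 and Table 1 (49a1)] -/
theorem numRealComponents_eq_one_of_j_eq_neg3375 (hj : W.j = -3375) :
    (W.baseChange ℝ).numRealComponents = 1 :=
  numRealComponents_eq_one_of_j_lt W (by rw [hj]; norm_num)

/-- `j = 16581375` (`49a2` and its twists): TWO real components. [cite: Cremona1997, §3.7 and Table 1 (49a2)] -/
theorem numRealComponents_eq_two_of_j_eq_16581375 (hj : W.j = 16581375) :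
    (W.baseChange ℝ).numRealComponents = 2 :=
  numRealComponents_eq_two_of_lt_j W (by rw [hj]; norm_num)

end RealComponents

/-! ## §2 `#E(ℚ)_tors = 2` on the whole `ℚ(√−7)` corner -/

/-- `5` is not a square modulo `7` (the squares are `0, 1, 2, 4`). [folklore] -/
theorem not_isSquare_five_zmod_seven : ¬ IsSquare ((5 : ℤ) : ZMod 7) := by decide

/-- `(−7/ℓ) = −1` for a prime `ℓ ≡ 5 (mod 28)`: `ℓ ≡ 1 (mod 4)` so `(−1/ℓ) = 1` and, by reciprocity,
`(7/ℓ) = (ℓ/7) = (5/7) = −1`. Such `ℓ` are INERT in `ℚ(√−7)`. [folklore] -/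
theorem legendreSym_neg_seven_eq_neg_one {ℓ : ℕ} [Fact ℓ.Prime] (hℓ : ℓ % 28 = 5) :
    legendreSym ℓ (-7) = -1 := by
  haveI : Fact (Nat.Prime 7) := ⟨by norm_num⟩
  have hℓ2 : ℓ ≠ 2 := by omega
  have hℓ4 : ℓ % 4 = 1 := by omega
  have hℓ7 : ((ℓ : ℤ) % 7) = 5 := by omega
  have h1 : legendreSym ℓ (-1) = 1 := by
    rw [legendreSym.at_neg_one hℓ2, ZMod.χ₄_nat_one_mod_four hℓ4]
  have h7 : legendreSym ℓ 7 = -1 := by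
    have hrec := legendreSym.quadratic_reciprocity_one_mod_four hℓ4 (show (7 : ℕ) ≠ 2 by norm_num)
    push_cast at hrec
    rw [← hrec, legendreSym.mod 7 (ℓ : ℤ)]
    have h5 : (ℓ : ℤ) % ((7 : ℕ) : ℤ) = 5 := by exact_mod_cast hℓ7
    rw [h5]
    exact (legendreSym.eq_neg_one_iff 7).mpr not_isSquare_five_zmod_seven
  rw [show (-7 : ℤ) = (-1) * 7 by norm_num, legendreSym.mul, h1, h7]
  norm_num

/-- Dirichlet: primes `ℓ ≡ 5 (mod 28)` beyond any bound (Mathlib `Nat.forall_exists_prime_gt_and_eq_mod`).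
[folklore] -/
theorem exists_prime_gt_mod_twentyEight_eq_five (n : ℕ) :
    ∃ ℓ : ℕ, n < ℓ ∧ ℓ.Prime ∧ ℓ % 28 = 5 := by
  haveI : NeZero (28 : ℕ) := ⟨by norm_num⟩
  have hcop : (5 : ℕ).Coprime 28 := by decide
  obtain ⟨ℓ, hℓn, hℓ, hℓk⟩ :=
    Nat.forall_exists_prime_gt_and_eq_mod ((ZMod.isUnit_iff_coprime 5 28).mpr hcop) n
  refine ⟨ℓ, hℓn, hℓ, ?_⟩
  have hmod : ℓ ≡ 5 [MOD 28] := (ZMod.natCast_eq_natCast_iff ℓ 5 28).mp hℓk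
  exact hmod

/-- **Every rational torsion point of a `ℚ(√−7)`-CM curve is killed by `2`** (globally minimal model;
see `torsionOrder_eq_two_of_cmSplit_two'` for any model). Proof in the module docstring: an inert good
prime `ℓ ≡ 5 (mod 28)` has `#Ẽ(𝔽_ℓ) = ℓ + 1 = 2·odd`, the order of a torsion point divides it
(*AEC* VII.3.1(b)) and has no odd prime factor (CM: no rational `q`-torsion for `q = 3` by
irreducibility, `q ≥ 5` by Deuring–Dirichlet). [cite: SilvermanAEC2009, VII.3.1(b) and Cor. VII.7.2]
[cite: Lang1987, Ch. 13 §4 Thm. 12 (PDF p. 140)] -/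
theorem two_nsmul_eq_zero_of_isOfFinAddOrder_of_cmSplit_two (W : WeierstrassCurve ℚ) [W.IsElliptic]
    [W.IsGloballyMinimal] (h : CMSplit W 2) (P : W.toAffine.Point) (hP : IsOfFinAddOrder P) :
    2 • P = 0 := by
  have hCM : W.HasCM := hasCM_of_cmSplit_two W h
  have hd : cmFieldDiscrOfJ W.j = -7 :=
    BurungaleCastellaSkinnerTian2022.cmFieldDiscrOfJ_eq_of_cmSplit_two W h
  have hj : W.j ∈ cmJInvariants := (hasCM_iff_j_mem_holds W).mp hCM
  -- a globally minimal maximal-order model in the isogeny class, same CM field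
  obtain ⟨W₁, hE₁, hmin₁, hiso₁, hj₁, hd₁⟩ :=
    X12.exists_isGloballyMinimal_isIsogenous_maximal_cmFieldDiscr_eq W hj
  haveI := hE₁
  haveI := hmin₁
  rw [hd] at hd₁
  -- a large prime `ℓ ≡ 5 (mod 28)`
  obtain ⟨ℓ, hℓn, hℓP, hℓmod⟩ := exists_prime_gt_mod_twentyEight_eq_five
    (max (minimalDiscriminantInt W).natAbs (minimalDiscriminantInt W₁).natAbs)
  haveI : Fact ℓ.Prime := ⟨hℓP⟩
  have hℓ3 : 3 ≤ ℓ := by omega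
  have hℓΔ : ¬ (ℓ : ℤ) ∣ minimalDiscriminantInt W :=
    X12.natCast_not_dvd_of_natAbs_lt (W.minimalDiscriminantInt_ne_zero)
      (lt_of_le_of_lt (le_max_left _ _) hℓn)
  have hℓΔ₁ : ¬ (ℓ : ℤ) ∣ minimalDiscriminantInt W₁ :=
    X12.natCast_not_dvd_of_natAbs_lt (W₁.minimalDiscriminantInt_ne_zero)
      (lt_of_le_of_lt (le_max_right _ _) hℓn)
  have hgood : W.HasGoodReductionAtPrime ℓ := hasGoodReductionAtPrime_of_not_dvd W ℓ hℓΔ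
  have hgood₁ : W₁.HasGoodReductionAtPrime ℓ := hasGoodReductionAtPrime_of_not_dvd W₁ ℓ hℓΔ₁
  -- Deuring at the inert prime `ℓ`: `a_ℓ(W₁) = 0`, hence `a_ℓ(W) = 0`
  have hℓd : ¬ (ℓ : ℤ) ∣ 2 * cmFieldDiscr W₁.j := by
    rw [hd₁]
    intro hdiv
    have h14 : (ℓ : ℤ) ∣ 14 := by
      have := dvd_neg.mpr hdiv
      norm_num at this
      exact this
    have h14' : ℓ ∣ 14 := by exact_mod_cast h14
    have hle : ℓ ≤ 14 := Nat.le_of_dvd (by norm_num) h14'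
    have h5 : ℓ = 5 := by omega
    rw [h5] at h14'
    exact absurd h14' (by decide)
  have hinert : legendreSym ℓ (cmFieldDiscr W₁.j) = -1 := by
    rw [hd₁]
    exact legendreSym_neg_seven_eq_neg_one hℓmod
  have htr₁ : W₁.frobeniusTrace ℓ = 0 :=
    X12.frobeniusTrace_eq_zero_of_legendreSym_cmFieldDiscr_eq_neg_one W₁ hj₁ ℓ hℓd hℓΔ₁ hinert
  have htr : W.frobeniusTrace ℓ = 0 :=
    (frobeniusTrace_eq_of_isIsogenous hiso₁ ℓ hgood hgood₁).trans htr₁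
  have hN : W.reductionPointCount ℓ = ℓ + 1 := by
    simp only [WeierstrassCurve.frobeniusTrace] at htr
    omega
  -- the order of `P` divides `#Ẽ(𝔽_ℓ) = ℓ + 1`
  have hdvd : addOrderOf P ∣ ℓ + 1 := hN ▸ addOrderOf_dvd_reductionPointCount W ℓ hℓ3 hℓΔ hP
  have hn0 : addOrderOf P ≠ 0 := hP.addOrderOf_pos.ne'
  -- no odd prime divides the order of `P`
  have hprime : ∀ {q : ℕ}, q.Prime → q ∣ addOrderOf P → q = 2 := by
    intro q hq hqd
    by_contra hq2
    haveI : Fact q.Prime := ⟨hq⟩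
    have hQord : addOrderOf ((addOrderOf P / q) • P) = q := addOrderOf_nsmul_addOrderOf_sub hn0 hqd
    have hQ0 : (addOrderOf P / q) • P ≠ 0 := by
      intro h0
      rw [h0, addOrderOf_zero] at hQord
      exact hq.one_lt.ne hQord
    have hqQ : q • ((addOrderOf P / q) • P) = 0 := by
      have h := addOrderOf_nsmul_eq_zero ((addOrderOf P / q) • P)
      rwa [hQord] at h
    rcases Nat.lt_or_ge q 5 with hlt | hge
    · have hq3 : q = 3 := by
        have h2le := hq.two_le
        interval_cases q
        · exact absurd rfl hq2
        · rfl
        · exact absurd hq (by decide)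
      subst hq3
      have hnr : ¬ CMRamified W 3 := by
        unfold CMRamified
        rw [hd]
        decide
      exact hQ0 (X12.noPTorsion_isogenyClass_of_not_cmRamified W (p := 3) (by norm_num) hnr W
        (isIsogenous_self W) _ hqQ)
    · exact hQ0 (X12.eq_zero_of_nsmul_eq_zero_of_hasCM W hCM hge _ hqQ)
  -- so the order of `P` is a power of `2` dividing `ℓ + 1 ≡ 2 (mod 4)`: it divides `2`
  obtain ⟨k, hpow⟩ : ∃ k : ℕ, addOrderOf P = 2 ^ k :=
    ⟨_, Nat.eq_prime_pow_of_unique_prime_dvd hn0 (fun hq hqd => hprime hq hqd)⟩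
  have hk : k ≤ 1 := by
    by_contra hk
    push Not at hk
    have h4 : 4 ∣ addOrderOf P := by
      rw [hpow]
      exact (Nat.pow_dvd_pow 2 hk : 2 ^ 2 ∣ _)
    have : 4 ∣ ℓ + 1 := h4.trans hdvd
    omega
  have h2 : addOrderOf P ∣ 2 := by
    rw [hpow]
    exact (Nat.pow_dvd_pow 2 hk).trans (by norm_num)
  exact addOrderOf_dvd_iff_nsmul_eq_zero.mp h2

/-- **`#E(ℚ)_tors = 2` for every `ℚ(√−7)`-CM curve (globally minimal model).** The torsion
subgroup is killed by `2` (`two_nsmul_eq_zero_of_isOfFinAddOrder_of_cmSplit_two`) and `E(ℚ)[2]` has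
exactly one non-zero point (`X12.existsUnique_twoTorsion_of_cmFieldDiscrOfJ_eq_neg_seven`).
[cite: BurungaleCastellaSkinnerTian2022, Rem. D (p. 327)] [cite: SilvermanAEC2009, VII.3.1(b)] -/
theorem torsionOrder_eq_two_of_cmSplit_two (W : WeierstrassCurve ℚ) [W.IsElliptic]
    [W.IsGloballyMinimal] (h : CMSplit W 2) : W.torsionOrder = 2 := by
  rw [torsionOrder_eq_natCard_torsion]
  haveI := finite_torsion_rat W
  obtain ⟨P₀, ⟨hP0, h2P⟩, huniq⟩ := X12.existsUnique_twoTorsion_of_cmFieldDiscrOfJ_eq_neg_seven W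
    (BurungaleCastellaSkinnerTian2022.cmFieldDiscrOfJ_eq_of_cmSplit_two W h)
  have hP₀tors : P₀ ∈ AddCommGroup.torsion W.toAffine.Point :=
    isOfFinAddOrder_iff_nsmul_eq_zero.mpr ⟨2, by norm_num, h2P⟩
  rw [Nat.card_eq_two_iff' (⟨P₀, hP₀tors⟩ : AddCommGroup.torsion W.toAffine.Point)]
  refine ⟨0, fun h0 => hP0 (congrArg Subtype.val h0).symm, fun y hy => ?_⟩
  by_contra hy0
  have hyfin : IsOfFinAddOrder (y : W.toAffine.Point) := y.2
  have hy2 : 2 • (y : W.toAffine.Point) = 0 :=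
    two_nsmul_eq_zero_of_isOfFinAddOrder_of_cmSplit_two W h y hyfin
  have hyne : (y : W.toAffine.Point) ≠ 0 := fun h0 => hy0 (Subtype.ext h0)
  exact hy (Subtype.ext (huniq y ⟨hyne, hy2⟩))

/-- **`#E(ℚ)_tors = 2` for every `ℚ(√−7)`-CM curve, ANY Weierstrass model** (`#E(ℚ)_tors` is
invariant under admissible changes of variables, `torsionOrder_variableChange_holds`; a global minimal
model exists, `hasGlobalMinimalModel_rat_holds`). E.g. `49a1`–`49a4` and all their quadratic twists.
[cite: BurungaleCastellaSkinnerTian2022, Rem. D (p. 327)] [cite: SilvermanAEC2009, VII.3.1(b) and VIII.8 Cor. 8.3] -/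
theorem torsionOrder_eq_two_of_cmSplit_two' (W : WeierstrassCurve ℚ) [W.IsElliptic]
    (h : CMSplit W 2) : W.torsionOrder = 2 := by
  obtain ⟨C, hC⟩ := hasGlobalMinimalModel_rat_holds W
  haveI := hC
  have h' : CMSplit (C • W) 2 := by
    unfold CMSplit at h ⊢
    rwa [variableChange_j]
  have hinv : (C • W).torsionOrder = W.torsionOrder := torsionOrder_variableChange_holds W C
  rw [← hinv]
  exact torsionOrder_eq_two_of_cmSplit_two (C • W) h'

/-- In `j`-currency: `j(W) ∈ {−3375, 16581375} ⟹ #E(ℚ)_tors = 2`. [cite: BurungaleCastellaSkinnerTian2022, Rem. D (p. 327)] -/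
theorem torsionOrder_eq_two_of_j_eq (W : WeierstrassCurve ℚ) [W.IsElliptic]
    (hj : W.j = -3375 ∨ W.j = 16581375) : W.torsionOrder = 2 :=
  torsionOrder_eq_two_of_cmSplit_two' W (cmSplit_two_of_j_eq W hj)

/-- **On the twin's class**: every curve in the hypothesis of `BSDTwoCMSplitRankOne` (globally
minimal, CM, `2` split) has `#E(ℚ)_tors = 2` and `1` or `2` real components according as
`j = −3375` or `j = 16581375` — the torsion and real-component factors of `P2.cmHeegnerIndexQuotient`
are constants on each `j`-slice of the corner. [cite: BurungaleCastellaSkinnerTian2022, Rem. D (p. 327)] [cite: Cremona1997, §3.7] -/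
theorem torsionOrder_and_numRealComponents_of_cmSplit_two (W : WeierstrassCurve ℚ) [W.IsElliptic]
    [W.IsGloballyMinimal] (h : CMSplit W 2) :
    W.torsionOrder = 2 ∧
      ((W.j = -3375 ∧ (W.baseChange ℝ).numRealComponents = 1) ∨
        (W.j = 16581375 ∧ (W.baseChange ℝ).numRealComponents = 2)) := by
  refine ⟨torsionOrder_eq_two_of_cmSplit_two W h, ?_⟩
  rcases j_eq_of_cmSplit_two W h with hj | hj
  · exact Or.inl ⟨hj, numRealComponents_eq_one_of_j_eq_neg3375 W hj⟩
  · exact Or.inr ⟨hj, numRealComponents_eq_two_of_j_eq_16581375 W hj⟩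

end Summit.BirchSwinnertonDyer.BirchSwinnertonDyer.Theorems.GoldfeldGoodTwists

end
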